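import Literature.NumberTheory.LFunctions.KeiperLiPositivityUpTo
import Literature.NumberTheory.LFunctions.XiMultiplePositivityExpFactors
import Literature.NumberTheory.LFunctions.RiemannHypothesisUpTo100000X
import Literature.NumberTheory.LFunctions.RiemannHypothesisUpTo1000X
import HarnessLib

/-!
# Li's criterion for `n ≤ 628 293` and `ξ₁ ∈ PF_m` for `m ≤ 314 158` — unconditional named cases of
# two RH criteria from the tree's certified heights `10⁵` (compiled) and `10³` (kernel)

Topic `Literature/NumberTheory/LFunctions`. Companion of `JensenHyperbolicityRangesRS.lean` (the Jensen
polynomial ranges from the same heights). Two further "verified height ⇒ initial segment of an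
RH-criterion" reductions of the tree, both with real proofs, are instantiated at the two heights of `ζ`
that the tree certifies WITHOUT any named fact:

* **Li's criterion** (`RH ↔ λₙ ≥ 0 ∀ n ≥ 1`, tree `li_criterion_holds`). The reduction
  `keiperLiCoeff_nonneg_of_riemannHypothesisUpTo` (`KeiperLiPositivityUpTo.lean`; F. Brown, J. Number
  Theory 111 (2005), Thm. 2, case `ζ`, linear sub-range `1 ≤ n ≤ 2π(T − 4)`) at
  `T = 10⁵` (`riemannHypothesisUpTo_100000`, `RiemannHypothesisUpTo100000X.lean`: Riemann–Siegel sign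
  certificate of the `138 069` zeros with the PROVED remainder bound + Turing's method, compiled
  evaluation) gives **`λₙ ≥ 0` for every `1 ≤ n ≤ 628 293`** (`keiperLiCoeff_nonneg_of_le_628293`;
  `628 293 ≤ 2π · 99 996 = 628 293.4…`); at `T = 10³` (`riemannHypothesisUpTo_1000`,
  `RiemannHypothesisUpTo1000X.lean`, the same certificate format checked by the KERNEL, standard axioms)
  it gives `λₙ ≥ 0` for `1 ≤ n ≤ 6 258` (`keiperLiCoeff_nonneg_of_le_6258`; `2π · 996 = 6 258.05…`).
  Before this file the tree had the sign of `λₙ` only conditionally (`keiperLiCoeff_nonneg_of_plattTrudgian`,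
  `n ≤ 1.885·10¹³` on the named hypothesis `riemannHypothesisUpTo_platt_trudgian`). For comparison, the
  certified TABLES of `λₙ` in print reach `n = 10⁵` (F. Johansson, Numer. Algorithms 69 (2015), §4.2);
  the sign statement here is a theorem for `6.28` times that range.
* **Katkova's multiple positivity** (`RH ↔ ξ₁ ∈ PF_∞`, tree `katkova_rh_iff_pf_holds` /
  `riemannHypothesis_iff_isPolyaFrequencySeq_xi`). The reduction
  `isMultiplyPositiveSeq_xi_of_riemannHypothesisUpTo` (`KatkovaPF44Proofs.lean`; Katkova 2006, remark
  after Thm. 1: RH to height `T ≥ (m+1)/π` ⇒ `(γ(n)/n!)ₙ` is `m`-times positive, via Hadamard's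
  factorisation and Schoenberg's Theorem B, both proved in the tree) gives **`ξ₁ ∈ PF_m` for every
  `m ≤ 314 158`** from `T = 10⁵` (`isMultiplyPositiveSeq_xi_of_le_314158`; `314 159 ≤ 10⁵ π`) and
  `m ≤ 3 140` from the kernel height `T = 10³` (`isMultiplyPositiveSeq_xi_of_le_3140`); the tree's
  previous unconditional order was `49` (`isMultiplyPositiveSeq_xi_fortyNine`, from `RH` to height `16`).
  Equivalently: every Toeplitz minor of order `≤ 314 158` of `(γ(n)/n!)ₙ` is `≥ 0`, so a negative
  certificate for the route `TotalPositivity` must have order `> 314 158`. Katkova's Theorem 3 (i)(ii)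
  (`e^{nz} ξ₁`, `cosh(n√z) ξ₁ ∈ PF_m`, `XiMultiplePositivityExpFactors.lean`) follows for the same `m` and
  every `n` (`katkova_exp_cosh_pf_of_le_314158`).

Auxiliary axioms: the `10⁵` statements inherit the compiled-evaluation axioms (`Lean.ofReduceBool`,
`Lean.trustCompiler`) of `riemannHypothesisUpTo_100000` (16 `native_decide` data checks, listed in
`RiemannHypothesisUpTo100000X.lean`); the `10³` statements are kernel-checked, standard axioms only.
Nothing about further coefficients follows from such ranges (Li's and Katkova's criteria are
equivalences with RH only in the limit `n, m → ∞`).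

## References

* [BrownLiCriterion2005] F. Brown, *Li's criterion and zero-free regions of `L`-functions*, J. Number
  Theory 111 (2005) 1–32, Thm. 2.
* [Li1997] X.-J. Li, *The positivity of a sequence of numbers and the Riemann hypothesis*, J. Number
  Theory 65 (1997) 325–333.
* [Katkova2006] O. M. Katkova, *Multiple positivity and the Riemann zeta-function*, Comput. Methods
  Funct. Theory 7 (2007) 13–31 = arXiv:math/0505174, Thm. 1 and the remark following it, Thm. 3.
* [Brent1979] R. P. Brent, Math. Comp. 33 (1979), §4 (the sign-certificate + Turing format).
-/

noncomputable section

namespace Literature.NumberTheory.LFunctions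

open Literature.NumberTheory.DiophantineGeometry Literature.Analysis.TotalPositivity
open scoped Nat

/-! ### Li's criterion: `λₙ ≥ 0` for `n ≤ 628 293` (compiled) and `n ≤ 6 258` (kernel) -/

/-- **Li's coefficients are non-negative for every `1 ≤ n ≤ 628 293`**, unconditionally (compiled
evaluation, no named fact): Brown's reduction `keiperLiCoeff_nonneg_of_riemannHypothesisUpTo`
(`RH` to height `T` ⇒ `λₙ ≥ 0` for `1 ≤ n ≤ 2π(T − 4)`) at the tree's certified height `T = 10⁵`
(`riemannHypothesisUpTo_100000`); `628 293 ≤ 2π(10⁵ − 4)`.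
[cite: BrownLiCriterion2005, Thm. 2 (case ζ, sub-range 1 ≤ n ≤ 2π(T−4), at T = 10⁵)] -/
theorem keiperLiCoeff_nonneg_of_le_628293 {n : ℕ} (hn : 1 ≤ n) (hn' : n ≤ 628293) :
    0 ≤ keiperLiCoeff n := by
  refine keiperLiCoeff_nonneg_of_riemannHypothesisUpTo riemannHypothesisUpTo_100000 hn ?_
  have h : (n : ℝ) ≤ 628293 := by exact_mod_cast hn'
  have hπ := Real.pi_gt_d6
  nlinarith

/-- Li's criterion (`li_criterion_holds`: `RH ↔ ∀ n ≥ 1, λₙ ≥ 0`) holds on the initial segment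
`1 ≤ n ≤ 628 293`, unconditionally (compiled evaluation).
[cite: BrownLiCriterion2005, Thm. 2 (case ζ, at T = 10⁵)] -/
theorem keiperLiCoeff_nonneg_upTo_628293 :
    ∀ n : ℕ, 1 ≤ n → n ≤ 628293 → 0 ≤ keiperLiCoeff n :=
  fun _ hn hn' => keiperLiCoeff_nonneg_of_le_628293 hn hn'

/-- **Li's coefficients are non-negative for every `1 ≤ n ≤ 6 258`, kernel-checked** (standard axioms
only): Brown's reduction at the tree's kernel-certified height `T = 10³` (`riemannHypothesisUpTo_1000`);
`6 258 ≤ 2π(10³ − 4)`. [cite: BrownLiCriterion2005, Thm. 2 (case ζ, sub-range 1 ≤ n ≤ 2π(T−4), at T = 10³)] -/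
theorem keiperLiCoeff_nonneg_of_le_6258 {n : ℕ} (hn : 1 ≤ n) (hn' : n ≤ 6258) :
    0 ≤ keiperLiCoeff n := by
  refine keiperLiCoeff_nonneg_of_riemannHypothesisUpTo riemannHypothesisUpTo_1000 hn ?_
  have h : (n : ℝ) ≤ 6258 := by exact_mod_cast hn'
  have hπ := Real.pi_gt_d6
  nlinarith

/-! ### Katkova: `ξ₁ ∈ PF_m` for `m ≤ 314 158` (compiled) and `m ≤ 3 140` (kernel) -/

/-- **`ξ₁ ∈ PF_m` for every `m ≤ 314 158`**, unconditionally (compiled evaluation, no named fact):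
every Toeplitz minor of order `≤ 314 158` of `(γ(n)/n!)ₙ` is non-negative. Katkova's remark after
Thm. 1 made quantitative (`isMultiplyPositiveSeq_xi_of_riemannHypothesisUpTo`: RH to height `T`,
`m + 1 ≤ πT`) at the tree's certified height `T = 10⁵` (`riemannHypothesisUpTo_100000`);
`314 159 ≤ 10⁵ π`. Extends the tree's unconditional order `49` (`isMultiplyPositiveSeq_xi_fortyNine`).
[cite: Katkova2006, remark after Thm. 1 (at T = 10⁵)] -/
theorem isMultiplyPositiveSeq_xi_of_le_314158 {m : ℕ} (hm : m ≤ 314158) :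
    IsMultiplyPositiveSeq m (fun n => xiTaylorCoeff n / (n ! : ℝ)) := by
  refine isMultiplyPositiveSeq_xi_of_riemannHypothesisUpTo riemannHypothesisUpTo_100000 ?_
  have h : (m : ℝ) ≤ 314158 := by exact_mod_cast hm
  have hπ := Real.pi_gt_d6
  nlinarith

/-- **`ξ₁ ∈ PF_m` for every `m ≤ 3 140`, kernel-checked** (standard axioms only): the same reduction at
the kernel-certified height `T = 10³` (`riemannHypothesisUpTo_1000`); `3 141 ≤ 10³ π`.
[cite: Katkova2006, remark after Thm. 1 (at T = 10³)] -/
theorem isMultiplyPositiveSeq_xi_of_le_3140 {m : ℕ} (hm : m ≤ 3140) :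
    IsMultiplyPositiveSeq m (fun n => xiTaylorCoeff n / (n ! : ℝ)) := by
  refine isMultiplyPositiveSeq_xi_of_riemannHypothesisUpTo riemannHypothesisUpTo_1000 ?_
  have h : (m : ℝ) ≤ 3140 := by exact_mod_cast hm
  have hπ := Real.pi_gt_d6
  nlinarith

/-- **Katkova's Theorem 3 (i) ∧ (ii) for every `m ≤ 314 158` and every `n`, with `n₀ = 0`**,
unconditionally (compiled evaluation): `e^{nz} ξ₁ ∈ PF_m` and `cosh(n√z) ξ₁ ∈ PF_m`, from
`ξ₁ ∈ PF_m` (`isMultiplyPositiveSeq_xi_of_le_314158`) and the closure of `PF_m` under convolution with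
the `PF_∞` sequences of `e^{nz}`, `cosh(n√z)` (`katkova_exp_cosh_pf_of_isMultiplyPositiveSeq`).
Extends `katkova_exp_cosh_pf_of_le` (`m ≤ 49`). [cite: Katkova2006, Thm. 3 (for m ≤ 314 158, n₀ = 0)] -/
theorem katkova_exp_cosh_pf_of_le_314158 {m : ℕ} (hm : m ≤ 314158) (n : ℕ) :
    IsMultiplyPositiveSeq m
        (conv (fun k => (n : ℝ) ^ k / (k ! : ℝ)) (fun k => xiTaylorCoeff k / (k ! : ℝ))) ∧
      IsMultiplyPositiveSeq m
        (conv (fun k => (n : ℝ) ^ (2 * k) / ((2 * k) ! : ℝ))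
          (fun k => xiTaylorCoeff k / (k ! : ℝ))) :=
  katkova_exp_cosh_pf_of_isMultiplyPositiveSeq (isMultiplyPositiveSeq_xi_of_le_314158 hm) n

/-- Kernel-checked twin of `katkova_exp_cosh_pf_of_le_314158`: Theorem 3 (i) ∧ (ii) for every
`m ≤ 3 140` and every `n` (standard axioms only). [cite: Katkova2006, Thm. 3 (for m ≤ 3 140, n₀ = 0)] -/
theorem katkova_exp_cosh_pf_of_le_3140 {m : ℕ} (hm : m ≤ 3140) (n : ℕ) :
    IsMultiplyPositiveSeq m
        (conv (fun k => (n : ℝ) ^ k / (k ! : ℝ)) (fun k => xiTaylorCoeff k / (k ! : ℝ))) ∧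
      IsMultiplyPositiveSeq m
        (conv (fun k => (n : ℝ) ^ (2 * k) / ((2 * k) ! : ℝ))
          (fun k => xiTaylorCoeff k / (k ! : ℝ))) :=
  katkova_exp_cosh_pf_of_isMultiplyPositiveSeq (isMultiplyPositiveSeq_xi_of_le_3140 hm) n

end Literature.NumberTheory.LFunctions

end
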